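import Literature.Computability.ImplicitComplexity.SoftTypeAssignmentMachinePotential
import HarnessLib

/-!
# A sharing abstract machine for `STA₊`, V: completeness with a polynomial number of transitions

Conclusion of the machine files (GMR08 = Gaboardi–Marion–Ronchi Della Rocca 2008, §5.1, Table 6,
Lemma 5.4, Lemma 5.7, Thm. 5.12). If a closed term `T` reaches `0` by a leftmost-outermost
evaluation with `k` steps (by `Typing.lmo_normal_form_steps`, every accepting evaluation of a
typed program can be taken of polynomial length), then the machine `STA.KAM`, fed with the choice
bits of that evaluation, ACCEPTS within `KAM.fuel k |T| = 3 (k + 1) (k + 4) (|T| + 1)`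
transitions (`KAM.run_complete`); with soundness (`KAM.run_sound`) this gives the decision
procedure `KAM.accepts_iff`.

The proof is a simulation: between two leftmost steps the machine performs only silent
transitions, which strictly decrease the potential; a `β`/choice transition realises exactly
the next labelled step (determinism of the strategy given the label, `LmoL.deterministic`); the
rejecting configurations are impossible on an evaluation ending in `0` (shape lemmas of part II).
The heap grows by one cell per `β`-step and per entered abstraction only and all codes are
subterms of `T` — the polynomial space bound of GMR08 Lemma 5.10/5.11 in this setting.

## References

* [GaboardiMarionRonchidellarocca2008] GMR08, §5.1, Table 6, Lemma 5.4, 5.7, 5.9–5.11, Thm. 5.12.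
-/

namespace Literature.Computability.ImplicitComplexity

namespace STA

namespace KAM

/-! ### Completeness -/

/-- More fuel does not hurt. [folklore] -/
theorem run_mono {n m : ℕ} (hnm : n ≤ m) {o : List Bool} {s : State} (h : run n o s = true) : run m o s = true := by
  induction n generalizing m o s with
  | zero => simp [run] at h
  | succ n ih =>
    cases m with
    | zero => omega
    | succ m =>
      simp only [run] at h ⊢
      rcases hs : step o s with ⟨o', s'⟩ | _ | _
      · rw [hs] at h
        show run m o' s' = true
        exact ih (by omega) h
      · rfl
      · rw [hs] at h
        simp at h

/-- Splitting the first step off a labelled evaluation to `0` of a term that is not `0`. [folklore] -/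
theorem _root_.Literature.Computability.ImplicitComplexity.STA.RelL.exists_first {bs : List (Option Bool)} {M : Term}
    (h : RelL bs M zero) (hM : M ≠ zero) : ∃ b bs' N, bs = b :: bs' ∧ LmoL b M N ∧ RelL bs' N zero := by
  cases h with
  | nil => exact absurd rfl hM
  | cons h' hs => exact ⟨_, _, _, rfl, h', hs⟩

/-- **The simulation.** A well-formed small state whose represented term evaluates (leftmost,
labels `bs`) to `0` is accepted by the machine run on the choice bits of `bs` (followed by
anything), within fuel exceeding the potential plus `3 (R+1)(Z+1)` per remaining step.
[cite: GaboardiMarionRonchidellarocca2008, Lemma 5.4 and Thm. 5.12] -/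
theorem run_complete_aux (R Z : ℕ) : ∀ (n : ℕ) (s : State) (bs : List (Option Bool)) (rest : List Bool),
    WF s → Small Z s → s.heap.length + bs.length + (2 - s.depth) + 1 ≤ R → RelL bs (rd s) zero →
    phi R Z s + bs.length * (3 * ((R + 1) * (Z + 1))) < n → run n (labelBits bs ++ rest) s = true := by
  intro n
  induction n with
  | zero => intro s bs rest _ _ _ _ h; omega
  | succ n ih =>
    intro s bs rest hwf hsm hR hrel hphi
    simp only [run]
    rcases hstep : step (labelBits bs ++ rest) s with ⟨o', s'⟩ | _ | _
    · -- a transition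
      show run n o' s' = true
      obtain ⟨hwf', hsm', hcases⟩ := step_cases (R := R) hwf hsm (by omega) hstep
      rcases hcases with ⟨ho, hrd, hlt, hhd⟩ | ⟨ho, hl, hheap, hdep⟩ | ⟨bb, ho, hl, hheap, hdep⟩
      · -- silent
        rw [ho]
        exact ih s' bs rest hwf' hsm' (by omega) (by rwa [hrd]) (by omega)
      · -- β
        rw [ho]
        obtain ⟨b₀, bs', N, rfl, h₀, hrest⟩ := hrel.exists_first fun e => normal_zero _ (e ▸ hl.lmo.red)
        have hb₀ : b₀ = none := by
          have := h₀.isSome_eq hl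
          cases b₀ with
          | none => rfl
          | some _ => simp at this
        subst hb₀
        have hN : N = rd s' := h₀.deterministic hl
        subst hN
        have hphi' := phi_lt (R := R) (Z := Z) hwf' hsm' (by omega)
        refine ih s' bs' rest hwf' hsm' (by simp at hR ⊢; omega) hrest ?_
        simp only [List.length_cons] at hphi
        nlinarith
      · -- choice
        obtain ⟨b₀, bs', N, rfl, h₀, hrest⟩ := hrel.exists_first fun e => normal_zero _ (e ▸ hl.lmo.red)
        obtain ⟨bb₀, rfl⟩ : ∃ bb₀, b₀ = some bb₀ := by
          have := h₀.isSome_eq hl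
          cases b₀ with
          | none => simp at this
          | some bb₀ => exact ⟨bb₀, rfl⟩
        simp only [labelBits_cons_some, List.cons_append, List.cons.injEq] at ho
        obtain ⟨rfl, rfl⟩ := ho
        have hN : N = rd s' := h₀.deterministic hl
        subst hN
        have hphi' := phi_lt (R := R) (Z := Z) hwf' hsm' (by omega)
        refine ih s' bs' _ hwf' hsm' (by simp at hR ⊢; omega) hrest ?_
        simp only [List.length_cons] at hphi
        nlinarith
    · rfl
    · -- the machine cannot reject on an evaluation ending in `0`
      exfalso
      obtain ⟨code, env, stack, heap, depth⟩ := s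
      rcases step_reject hwf hstep with ⟨t, hc, hs, hd⟩ | ⟨t, u, hc, ho⟩ | ⟨i, c, ℓ, hc, hget, hcell, hcond⟩
      · change code = Term.lam t at hc
        change stack = [] at hs
        change depth = 2 at hd
        subst hc hs hd
        have : rd ⟨.lam t, env, [], heap, 2⟩ = lams 3 (t.substp (Term.up (rbEnv heap 2 heap.length env))) := by
          simp [rd, rbClo, Term.substp, apps, lams]
        rw [this] at hrel
        exact hrel.lams_three_ne_zero
      · change code = Term.sum t u at hc
        change labelBits bs ++ rest = [] at ho
        subst hc
        have hshape : rd ⟨.sum t u, env, stack, heap, depth⟩ =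
            lams depth (apps (.sum (t.substp (rbEnv heap depth heap.length env)) (u.substp (rbEnv heap depth heap.length env)))
              (stack.map fun cl => rbClo heap depth heap.length cl.1 cl.2)) := by
          simp [rd, rbClo, Term.substp]
        obtain ⟨b₀, bs', N, rfl, h₀, _⟩ := hrel.exists_first (by rw [hshape]; exact lams_apps_sum_ne_zero _ _ _ _)
        rw [hshape] at h₀
        obtain ⟨M', _, h₀'⟩ := h₀.of_lams (apps_ne_lam (fun P h => by cases h) _)
        obtain ⟨bb, rfl⟩ := h₀'.label_of_spineHead_sum (by rw [spineHead_apps]; rfl)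
        simp at ho
      · change code = Term.var i at hc
        change env[i]? = some c at hget
        change heap[c]? = some (Entry.abs ℓ) at hcell
        change ¬(stack = [] ∧ depth = 2 ∧ ℓ = 0) at hcond
        subst hc
        rw [rd_var_abs hwf hget hcell] at hrel
        have hℓ : ℓ < depth := hwf.heapAbs c ℓ hcell
        have hdep : depth ≤ 2 := hwf.depthLe
        have hva := VarApps.apps (depth - 1 - ℓ) (stack.map fun cl => rbClo heap depth heap.length cl.1 cl.2) VarApps.var
        obtain ⟨hD, hn, hj⟩ := hrel.lams_varApps_zero hva hdep
        simp only [Nat.zero_add, List.length_map, List.length_eq_zero_iff] at hn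
        exact hcond ⟨hn, hD, by omega⟩

/-- The fuel: `3 (k+1) (k+4) (|T|+1)` transitions. [folklore] -/
def fuel (k Z : ℕ) : ℕ := 3 * ((k + 4) * (Z + 1)) * (k + 1)

/-- The fuel is monotone in the step bound. [folklore] -/
theorem fuel_mono {k K : ℕ} (h : k ≤ K) (Z : ℕ) : fuel k Z ≤ fuel K Z := by
  unfold fuel
  have : (k + 4) * (Z + 1) ≤ (K + 4) * (Z + 1) := Nat.mul_le_mul_right _ (by omega)
  exact Nat.mul_le_mul (Nat.mul_le_mul_left _ this) (by omega)

/-- **Completeness of the machine.** If a closed term reaches `0` in `k ≤ K` leftmost-outermost steps,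
then some oracle of length `≤ K` makes the machine accept within `fuel K |T|` transitions.
[cite: GaboardiMarionRonchidellarocca2008, Lemma 5.4 and Thm. 5.12] -/
theorem run_complete {T : Term} (hT : T.fv = ∅) {k K : ℕ} (h : RelN Lmo k T zero) (hk : k ≤ K) :
    ∃ o : List Bool, o.length ≤ K ∧ run (fuel K T.size) o (init T) = true := by
  obtain ⟨bs, hlen, hbs⟩ := RelL.of_relN h
  refine ⟨labelBits bs, (length_labelBits_le bs).trans (by omega), ?_⟩
  have hphi : phi (k + 3) T.size (init T) < 3 * ((k + 3 + 1) * (T.size + 1)) :=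
    phi_lt (WF.init hT) (Small.init T) (by simp [KAM.init])
  have hrun := run_complete_aux (k + 3) T.size (phi (k + 3) T.size (init T) + k * (3 * ((k + 3 + 1) * (T.size + 1))) + 1)
    (init T) bs [] (WF.init hT) (Small.init T) (by simp [KAM.init, hlen]) (by rwa [rd_init]) (by rw [hlen]; omega)
  rw [List.append_nil] at hrun
  refine run_mono ?_ hrun
  refine le_trans ?_ (fuel_mono hk T.size)
  unfold fuel
  nlinarith

/-- **The machine decides acceptance.** For a closed term all of whose leftmost evaluations to `0`
are known to have length `≤ K` (for typed programs: `Typing.lmo_normal_form_steps`), `T →βγ* 0`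
iff some oracle of length `≤ K` makes the machine accept within `fuel K |T|` transitions.
[cite: GaboardiMarionRonchidellarocca2008, Thm. 5.12] -/
theorem accepts_iff {T : Term} (hT : T.fv = ∅) {K : ℕ} (hK : Reduces T zero → ∃ k, k ≤ K ∧ RelN Lmo k T zero) :
    Reduces T zero ↔ ∃ o : List Bool, o.length ≤ K ∧ run (fuel K T.size) o (init T) = true := by
  constructor
  · intro h
    obtain ⟨k, hk, hrel⟩ := hK h
    exact run_complete hT hrel hk
  · rintro ⟨o, _, h⟩
    exact run_sound hT h

end KAM

end STA

end Literature.Computability.ImplicitComplexity
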